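import Mathlib
import HarnessLib
import HarnessLib.Audit
import Summits.AtomisticToContinuum.Statement
import Literature.MathematicalPhysics.StatisticalMechanics.HaggStacking
import Summits.AtomisticToContinuum.Crystallization.Theorems.CrystalLocalRigidityAssembly
import Summits.AtomisticToContinuum.Crystallization.Theorems.RefuteCrystalPeriodicMinAssembly

/-!
Route: RefuteCrystalPeriodicMin

CLOSED (superseded) 2026-08-15T12:51:24Z by planner-AtomisticToContinuum-route-AtomisticToContinuum-RefuteCrystalPeriodicMin — reason: superseded:route-AtomisticToContinuum-PoissonBesselStacking — superseded by route-AtomisticToContinuum-PoissonBesselStacking — note: route-repair (planner, 2026-08-15): CLOSE as SUPERSEDED by route-AtomisticToContinuum-PoissonBesselStacking. CENSUS. Kill criterion of this negative route ("crux 2 resolving as J_2 dominates closes this route immediately") is met on all available evidence: two independent refuter computations (g2-7:. The file is kept as the record of this route; refuted decls are indexed as negative knowledge (`ledger negatives`).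

NEGATIVE ROUTE. X_¬ := the infimum over periodic (lattice + finite motif) configurations of ℝ³ of
the Lennard-Jones
energy per particle is NOT attained. Then HasPeriodicGroundStateEnergy lennardJones 3 fails (it
asserts a periodic
P that IsLeast), hence ¬Crystallization, hence ¬AtomisticToContinuum.
Mechanism: for LJ the optimal structures are close-packed Barlow stackings whose energy per
particle, after in-layer
and interlayer relaxation, is e₀ + Σ_{k≥2} J_k · (frequency of aligned layer pairs at distance k)
with an
infinite-range (J_k ~ k⁻⁴), sign-alternating/frustrated effective 1-D interaction on Hägg sequences;
if no finite set
of leading couplings dominates, the 1-D ground state can be a long-period or non-periodic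
(Sturmian/devil's-staircase)
sequence, and the infimum over periodic stackings is approached (period → ∞) but not attained.
Blanc–Lewin
(arXiv:1504.01153 p.11) note that already the sphere-packing limit has "even non-periodic" optimal
arrangements.
Lean (rank 0):
  ¬ ∃ P : Literature.MathematicalPhysics.StatisticalMechanics.PeriodicConfiguration 3, IsLeast
(Set.range fun Q : Literature.MathematicalPhysics.StatisticalMechanics.PeriodicConfiguration 3 =>
      Q.energyPerParticle Literature.MathematicalPhysics.StatisticalMechanics.lennardJones)
(P.energyPerParticle Literature.MathematicalPhysics.StatisticalMechanics.lennardJones)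
Assembly (rank 1): the above → ¬ AtomisticToContinuum (through ¬HasPeriodicGroundStateEnergy →
¬Crystallization).

Rationale: WHY THIS LINE. The conjunct Crystallization was formalised with ATTAINMENT of the periodic minimum
(HasPeriodicGroundStateEnergy: ∃ P, IsLeast … ∧ E(N)/N → e(P)). For Lennard-Jones in 3-D the
candidates are Barlow
stackings, distinguished only at 2nd/3rd-neighbour range (Flatley–Theil arXiv:1407.0692 p.5;
BlancLewin2015 §2.3;
physics numerics: HCP below FCC by ~10⁻⁴ relative, Kihara–Koba 1952, doi:10.1063/1.3606459). The
selection among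
ALL stackings is an infinite-range frustrated 1-D lattice model on Hägg sequences — an area (1-D
long-range ground
states: Hubbard/Bak–Bruinsma devil's staircases, Aubry theory, Morse–Hedlund/Sturmian sequences)
that has not been
brought to bear on the crystallization conjecture. Either outcome is informative: domination by J_2
proves route
CrystalLocalRigidity's crux (c); failure of domination opens a genuine refutation of the conjunct AS
FORMALISED
(the operator would then have to weaken "attained" to "infimum", which is a statement change,
D-0015).
Imported: certified computation (interval arithmetic for lattice sums with r⁻⁶ tails and relaxation
in (a,h)),
symbolic dynamics of 1-D ground states.

RANKED CRUXES:
 2. [certified numerics, informal] compute J_k(a,h), k = 2..K, with rigorous tail bounds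
Σ_{k>K}|J_k| and
    relaxation over the (a,h)-box containing all near-optimal stackings; decide whether
    |J_2| > Σ_{k≥3} k|J_k| (⇒ HCP, route closes) or not (⇒ continue).
 3. [informal] if domination fails: determine the ground states of the effective 1-D model
    H(s) = Σ_k J_k Σ_n 1[s_n+…+s_{n+k−1} ≡ 0 mod 3]; show the minimal energy density is not attained
by any periodic s
    (or is attained — then close).
 4. [informal] reduction lemma: inf over ALL periodic configurations of e equals inf over relaxed
Barlow stackings
    (this is CrystalLocalRigidity crux (a) in energetic form; without it non-attainment among
stackings does not
    refute (3a)).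
 5. [formal, rank 0 item] ¬(∃ P periodic, IsLeast (range e) (e P)).
KILL CRITERIA: crux 2 resolving as "J_2 dominates" closes this route immediately (and stamps
CrystalLocalRigidity
(c)); crux 4 failing (non-Barlow periodic structures competitive) makes the route ill-founded →
close.
NOT DECOMPOSED: distortions beyond uniform (a,h) relaxation (layer-dependent spacings make the 1-D
model a
variational problem with elastic coupling — only if crux 2 is marginal); the alternative refutation
"lim E(N)/N < min periodic" (quasicrystalline LJ ground states) is not pursued: no evidence.
SOURCES: BlancLewin2015 (arXiv:1504.01153) §2.3, p.11; Flatley–Theil arXiv:1407.0692 §1; Krainyukova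
2011
doi:10.1063/1.3606459 (role of distortion in hcp/fcc competition for rare-gas LJ solids).

History (route lifecycle, newest last):
- 2026-08-15T12:51:25Z · CLOSED superseded — superseded:route-AtomisticToContinuum-PoissonBesselStacking (planner-AtomisticToContinuum-route-AtomisticToContinuum-Refu)

sub-problem: Crystallization · status: closed(superseded) · opened planner-AtomisticToContinuum-Survey-0 2026-08-13T13:23:24Z · rev 0 · ledger route-AtomisticToContinuum-RefuteCrystalPeriodicMin
GENERATED by the gate from the ledger (D-0016/17). Provers cite these decls: `theorem foo : Summit.AtomisticToContinuum.Crystallization.Theses.RefuteCrystalPeriodicMin.<Decl> := …` in Summits/AtomisticToContinuum/Crystallization/Theorems/<Name>.lean.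
-/

namespace Summit.AtomisticToContinuum.Crystallization.Theses.RefuteCrystalPeriodicMin

open scoped BigOperators Topology Manifold Classical MeasureTheory ProbabilityTheory Matrix InnerProductSpace ComplexConjugate ContinuousMap
open Filter Set Function TopologicalSpace MeasureTheory

attribute [summit_statement] _root_.Crystallization

/-- item stmt-AtomisticToContinuum-0668 · crux · rank 0 · closed · moot by None · by planner
The infimum over periodic configurations of ℝ³ (full-rank lattice + finite motif) of the
Lennard-Jones energy per particle is NOT attained. Refutes HasPeriodicGroundStateEnergy lennardJones
3 as formalised (which asserts a least element), hence Crystallization, hence the summit. -/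
@[route_item "route-AtomisticToContinuum-RefuteCrystalPeriodicMin"]
def RefuteCrysThesis : Prop :=
  ¬ ∃ P : Literature.MathematicalPhysics.StatisticalMechanics.PeriodicConfiguration 3, IsLeast (Set.range fun Q : Literature.MathematicalPhysics.StatisticalMechanics.PeriodicConfiguration 3 => Q.energyPerParticle Literature.MathematicalPhysics.StatisticalMechanics.lennardJones) (P.energyPerParticle Literature.MathematicalPhysics.StatisticalMechanics.lennardJones)

-- item stmt-AtomisticToContinuum-0670 · crux · rank 2 · closed · moot by None · by planner — informal only, no Lean statement yet:
--   CERTIFIED COMPUTATION: for Lennard-Jones V(r) = r⁻¹²/12 − r⁻⁶/6 and Barlow stackings with in-layer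
--   spacing a and interlayer spacing h in a box B ⊂ ℝ² certified to contain all (a,h) of near-optimal
--   stackings, compute with interval arithmetic the interlayer alignment couplings J_k(a,h) := Σ_{y ∈
--   aligned layer at height kh} V(|y|) − Σ_{y ∈ non-aligned layer at height kh} V(|y|) for k = 2..K
--   together with a rigorous bound on Σ_{k>K} sup_B |J_k| (r⁻⁶ tail ⇒ O(K⁻³)); OUTPUT the verified truth
--   value of the domination inequality  sup_B ( Σ_{k≥3} k·|J_k(a,h)| − |J_2(a,h)| ) < 0  and the sign of
--   J_2 on

/-- item stmt-AtomisticToContinuum-0671 · support · rank 3 · closed · moot by None · by planner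
1-D SELECTION MODEL: for real couplings (J_k)_{k≥2} with Σ k|J_k| < ∞ define on Hägg sequences s : ℤ
→ {±1} the energy density h(s) = lim_n (2n)⁻¹ Σ_{|m|≤n} Σ_k J_k · 1[s_m + … + s_{m+k−1} ≡ 0 mod 3].
CLAIM (to prove or refute for the certified LJ couplings of the rank-2 item): inf_s h(s) is attained
by a periodic s. Its negation for the LJ couplings, combined with the reduction 'inf over periodic
configurations of e = e₀ + inf over periodic s of h(s)', yields the rank-0 non-attainment statement. -/
@[route_item "route-AtomisticToContinuum-RefuteCrystalPeriodicMin"]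
def RefuteCrys1dGroundstate : Prop :=
  ∀ J : ℕ → ℝ, Summable (fun k : ℕ => (k : ℝ) * |J k|) → J 2 + ∑' k : ℕ, (if 3 ≤ k then ((k : ℝ) - 1) * |J k| else 0) ≤ 0 → IsLeast (Set.range fun s : {s : ℤ → ℤ // Literature.MathematicalPhysics.StatisticalMechanics.IsHaggSeq s} => Literature.MathematicalPhysics.StatisticalMechanics.haggStackingEnergy J s.1) (Literature.MathematicalPhysics.StatisticalMechanics.haggStackingEnergy J Literature.MathematicalPhysics.StatisticalMechanics.alternatingHagg)

/-- item stmt-AtomisticToContinuum-0716 · support · rank 3 · closed · moot by None · by planner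
HÄGG DOMINATION LEMMA (combinatorial half of stacking selection; pure 1-D lattice-gas statement, no
LJ input): for couplings J_2, …, J_K with J_2 + Σ_{k=3}^{K} (k−1)|J_k| ≤ 0 and any n-periodic ±1
sequence s, the per-period stacking energy Σ_{m<n} Σ_{k=2}^{K} J_k·1[s_m+…+s_{m+k−1} ≡ 0 mod 3]
(layers m, m+k aligned) is ≥ n·Σ_{k even ≤ K} J_k = the value of the alternating sequence (ABAB =
HCP-type). Proof: Peierls count — each bad bond s_{m+1} = s_m loses |J_2| and lies in ≤ k−1 windows
of length k; windows without bad bonds have the alternating alignment status (sum 0 or ±1 by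
parity). With the certified numerics of 0670 (domination incl. tail, K → ∞ by monotone limit under Σ
k|J_k| < ∞) this settles 0671 POSITIVELY (periodic minimiser) and closes route
RefuteCrystalPeriodicMin; it is also the deterministic half of CrystalLocalRigidity crux (c) 0628.
Suggested by refuter g2-1 on 0628. -/
@[route_item "route-AtomisticToContinuum-RefuteCrystalPeriodicMin"]
def HaggDominationPeriod2 : Prop :=
  ∀ (K n : ℕ) (J : ℕ → ℝ) (s : ℤ → ℤ), 0 < n → (∀ i, s i = 1 ∨ s i = -1) → (∀ i, s (i + n) = s i) → J 2 + ∑ k ∈ Finset.Icc 3 K, ((k : ℝ) - 1) * |J k| ≤ 0 → (n : ℝ) * ∑ k ∈ (Finset.Icc 2 K).filter (fun k => Even k), J k ≤ ∑ m ∈ Finset.range n, ∑ k ∈ Finset.Icc 2 K, (if (∑ i ∈ Finset.range k, s ((m : ℤ) + i)) % 3 = 0 then J k else 0)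

/-- item stmt-AtomisticToContinuum-0737 · support · rank 3 · open · by planner
HÄGG DOMINATION, ALL RANGES, ARBITRARY (non-periodic) Hägg sequence, finite volume with O(1)
boundary term — the Mathlib-only core from which 0671 (typed: alternatingHagg minimises
haggStackingEnergy over all Hägg sequences under summable domination) follows by dividing by n and
taking liminf (haggStackingEnergy_alternating = tsum of even J_k is in HaggStacking.lean).
Statement: for J with Σ k|J_k| < ∞ and J_2 + Σ_{k≥3}(k−1)|J_k| ≤ 0, every ±1 sequence s and every n:
n·Σ_{k≥2 even} J_k ≤ H_n(J,s) + Σ_k k|J_k|, where H_n(J,s) = Σ_{m<n} Σ'_{k≥2} J_k·1[s_m+…+s_{m+k−1}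
≡ 0 mod 3] (= Literature.MathematicalPhysics.StatisticalMechanics.haggEnergy n J s definitionally).
Proof (Peierls count as in 0716, refuters g2-0/g2-1/g3-2): b := #{m<n : s(m+1) = s(m)}; k = 2
contributes exactly J_2(n − b); for k ≥ 3 a window m..m+k−1 with all internal bonds in [0,n) and
none bad is alternating, hence aligned iff k even; windows m<n containing a bad internal bond j<n
number ≤ (k−1)b, windows with an internal bond ≥ n number ≤ k−1; so |A_k − n[k even]| ≤ (k−1)(b+1)
and RHS − LHS ≥ b(−J_2 − Σ_{k≥3}(k−1)|J_k|) − Σ_{k≥3}(k−1)|J_k| ≥ −Σ_k k|J_k|. Extends 0716 (finite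
K, periodic s) to K = ∞ and aperiodic s; -/
@[route_item "route-AtomisticToContinuum-RefuteCrystalPeriodicMin"]
def HaggDominationAllRanges : Prop :=
  ∀ (J : ℕ → ℝ) (s : ℤ → ℤ) (n : ℕ), (∀ i, s i = 1 ∨ s i = -1) → Summable (fun k : ℕ => (k : ℝ) * |J k|) → J 2 + ∑' k : ℕ, (if 3 ≤ k then ((k : ℝ) - 1) * |J k| else 0) ≤ 0 → (n : ℝ) * ∑' k : ℕ, (if 2 ≤ k ∧ Even k then J k else 0) ≤ (∑ m ∈ Finset.range n, ∑' k : ℕ, (if 2 ≤ k ∧ (∑ i ∈ Finset.range k, s ((m : ℤ) + i)) % 3 = 0 then J k else 0)) + ∑' k : ℕ, (k : ℝ) * |J k|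

-- item stmt-AtomisticToContinuum-0672 · support · rank 4 · closed · moot by None · by planner — informal only, no Lean statement yet:
--   REDUCTION LEMMA: the infimum over all periodic configurations of ℝ³ of the LJ energy per particle
--   equals the infimum over periodic relaxed Barlow stackings (parameters a, h and Hägg sequence), i.e.
--   no non-close-packed periodic structure is competitive. (Energetic local optimality of close packing
--   for LJ at the optimal density; shared in substance with CrystalLocalRigidity crux (a). Without it,
--   aperiodicity of optimal stackings does not refute attainment.)

/-- item stmt-AtomisticToContinuum-0627 · support · rank 5 · open · by planner
The infimum over periodic configurations of ℝ³ of the Lennard-Jones energy per particle is attained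
(by some lattice G and finite motif F). Needs stacking selection (c) + compactness of near-optimal
periodic configurations at bounded density / bounded-below distances; refuted if optimal LJ
stackings are aperiodic with unattained infimum (route RefuteCrystalPeriodicMin). -/
@[route_item "route-AtomisticToContinuum-RefuteCrystalPeriodicMin"]
def CrysPeriodicMinAttained : Prop :=
  ∃ P : Literature.MathematicalPhysics.StatisticalMechanics.PeriodicConfiguration 3, IsLeast (Set.range fun Q : Literature.MathematicalPhysics.StatisticalMechanics.PeriodicConfiguration 3 => Q.energyPerParticle Literature.MathematicalPhysics.StatisticalMechanics.lennardJones) (P.energyPerParticle Literature.MathematicalPhysics.StatisticalMechanics.lennardJones)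

/-- item stmt-AtomisticToContinuum-0624 · assembly · rank 1 · closed · proved by Literature.StatMech.atomisticToContinuum_of_conjuncts (refuter) · by planner
Summit assembly: the four conjuncts imply AtomisticToContinuum (AtomisticToContinuum_iff). Shared by
all routes. -/
@[route_item "route-AtomisticToContinuum-RefuteCrystalPeriodicMin"]
def Assembly : Prop :=
  Literature.MathematicalPhysics.KineticTheory.HydrodynamicLimit ∧ Literature.MathematicalPhysics.KineticTheory.HeatConduction.FouriersLaw ∧ Literature.MathematicalPhysics.StatisticalMechanics.Crystallization ∧ Literature.MathematicalPhysics.QuantumManyBody.BoseGas.BoseEinsteinCondensation → AtomisticToContinuum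

/-- `Assembly` holds: proved by `Literature.StatMech.atomisticToContinuum_of_conjuncts`. -/
theorem Assembly_holds : Assembly := _root_.Literature.StatMech.atomisticToContinuum_of_conjuncts

/-- item stmt-AtomisticToContinuum-0669 · assembly · rank 1 · closed · proved by Literature.StatMech.not_atomisticToContinuum_of_not_periodic_min_attained (refuter) · by planner
Assembly of the negative route: non-attainment of the periodic LJ minimum →
¬HasPeriodicGroundStateEnergy lennardJones 3 → ¬Crystallization → ¬AtomisticToContinuum (pure
unfolding). -/
@[route_item "route-AtomisticToContinuum-RefuteCrystalPeriodicMin"]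
def Assembly2 : Prop :=
  (¬ ∃ P : Literature.MathematicalPhysics.StatisticalMechanics.PeriodicConfiguration 3, IsLeast (Set.range fun Q : Literature.MathematicalPhysics.StatisticalMechanics.PeriodicConfiguration 3 => Q.energyPerParticle Literature.MathematicalPhysics.StatisticalMechanics.lennardJones) (P.energyPerParticle Literature.MathematicalPhysics.StatisticalMechanics.lennardJones)) → ¬ AtomisticToContinuum

/-- `Assembly2` holds: proved by `Literature.StatMech.not_atomisticToContinuum_of_not_periodic_min_attained`. -/
theorem Assembly2_holds : Assembly2 := _root_.Literature.StatMech.not_atomisticToContinuum_of_not_periodic_min_attained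

end Summit.AtomisticToContinuum.Crystallization.Theses.RefuteCrystalPeriodicMin
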